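import Literature.AlgebraicGeometry.ModuliOfAbelianVarieties.SiegelShimuraSetDissection
import Literature.AlgebraicGeometry.ModuliOfAbelianVarieties.SymplecticSimilitudeMultiplierSection
import Literature.AlgebraicGeometry.ModuliOfAbelianVarieties.SymplecticFormTransport
import Literature.NumberTheory.Automorphic.StrongApproximationSp
import HarnessLib

/-!
# The piece index `GSp_δ(ℚ)∖GSp_δ(𝔸_f)/K` is read by the multiplier (strong approximation for `Sp_{2g}`)

Topic `AlgebraicGeometry/ModuliOfAbelianVarieties`; namespace `Literature.AlgebraicGeometry.ModuliOfAbelianVarieties.SiegelShimuraSet`.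
THEOREMS ONLY (no definition, no named fact, no instance, no `sorry`).

For an OPEN subgroup `K ≤ GSp_δ(𝔸_{ℚ,f})` the index `Ξ_K = GSp_δ(ℚ)∖GSp_δ(𝔸_{ℚ,f})/K` of ★ R60-13
(`SiegelShimuraSet.Index δ K`, `indexOf`) only sees MULTIPLIERS: **two finite-adelic points with a common multiplier have
the same index** (`indexOf_eq_indexOf_of_isMultiplier`).  Proof ([Milne2005ShimuraVarieties] Lemma 5.12 / proof of Thm. 5.17,
«`ν : G(𝔸_f) → 𝔸_f^×` … the fibres are `G'(ℚ)\G'(𝔸_f)`-torsors, trivial by strong approximation for the simply connected `G' = Sp`»):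
`s = b a⁻¹ ∈ Sp(E_δ)(𝔸_f) = P_δ⁻¹·Sp(J)(𝔸_f)·P_δ` (★ `SymplecticFormTransport`); by STRONG APPROXIMATION for `Sp_{2g}`
(★ R60-8 `Automorphic.exists_symplecticGroup_map_mul_eq_of_isOpen`)
`P s P⁻¹ = γ u` with `γ ∈ Sp(J)(ℚ)` and `u` in the open subgroup `P a K a⁻¹ P⁻¹ ∩ Sp(J)(𝔸_f)`; transporting back,
`b = γ' a k` with `γ' ∈ Sp(E_δ)(ℚ) ≤ GSp_δ(ℚ)` and `k ∈ K`.  §1 is the topological bridge «`Sp(J)(𝔸_f)` with its MATRIX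
topology maps continuously into `GL_{2g}(𝔸_f)` with its UNITS topology» (the inverse `−J xᵀ J` is polynomial); §2 the
transport of rational points; §3 the theorem and its corollaries (`indexOf` is constant on multiplier fibres; moving by
`GSp_δ(ℚ)` and `K`).

D-CITE docstring edition (lit2 audit `lit/D-CITE-AUDIT-ClusterI-II.md` row :76, grade A): [Milne2005ShimuraVarieties] Thm. 5.17
re-paged 61 → 59 (the `π₀` theorem's STATEMENT is p. 59 of the 2017 revision; pp. 60–61 carry its proof); only docstring text
changed — every declaration, statement and proof is byte-identical to ★ p655729.
Cell `hodgecm-mathlib`, #60 road (A-p05 TABLE, «piece-index count», B-p18 leaf #3 file A); banked generic leaf, books 0.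
HC_CM is proved only modulo the 7 printed citations until rung 0 closes.

## References
* [Milne2005ShimuraVarieties] J. S. Milne, *Introduction to Shimura varieties* (2005; 2017 revision), §4 Thm. 4.16 p. 48, Lemma 5.12
  p. 57, Thm. 5.17 p. 59 (statement; proof pp. 60–61 with Lemma 5.20 p. 60, Lemma 5.21 p. 61), §6 p. 67.
* [PlatonovRapinchuk1994] V. Platonov, A. Rapinchuk, *Algebraic groups and number theory* (1994), §7.4 Thm. 7.12.
* [Deligne1971TravauxShimura] P. Deligne, *Travaux de Shimura* (1971), 1.8 p. 129, Exemple 4.16 p. 150.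
-/

set_option autoImplicit false

noncomputable section

open Matrix NumberField IsDedekindDomain
open _root_.Topology
open Literature.RepresentationTheory.HeisenbergGroup.SymplecticMatrix (mapHom coe_mapHom)

namespace Literature.AlgebraicGeometry.ModuliOfAbelianVarieties

/-! ### §1. `Sp(J)(R)` (matrix topology) → `GL(R)` (units topology) is a continuous homomorphism -/

section Bridge

variable {R : Type*} [CommRing R]
variable {l : Type*} [Fintype l] [DecidableEq l]

/-- The canonical homomorphism `Sp(J)(R) →* GL_{2l}(R)` (Mathlib's `toUnits` followed by `Units.map` of the inclusion)
has underlying matrix the given one. [cite: Milne2005ShimuraVarieties, §4 p. 48] -/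
@[simp] theorem coe_unitsMap_toUnits (x : Matrix.symplecticGroup l R) :
    ((((Units.map (Matrix.symplecticGroup l R).subtype).comp (toUnits (G := Matrix.symplecticGroup l R)).toMonoidHom) x :
        GL (l ⊕ l) R) : Matrix (l ⊕ l) (l ⊕ l) R) = (x : Matrix (l ⊕ l) (l ⊕ l) R) := rfl

/-- `GL_{2l}(f)` of the unit of a symplectic matrix is the unit of its entrywise image (`mapHom`).
[cite: Milne2005ShimuraVarieties, §4 p. 48] -/
theorem generalLinearGroup_map_unitsMap_toUnits {S : Type*} [CommRing S] (f : R →+* S) (x : Matrix.symplecticGroup l R) :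
    Matrix.GeneralLinearGroup.map f
        (((Units.map (Matrix.symplecticGroup l R).subtype).comp (toUnits (G := Matrix.symplecticGroup l R)).toMonoidHom) x) =
      ((Units.map (Matrix.symplecticGroup l S).subtype).comp (toUnits (G := Matrix.symplecticGroup l S)).toMonoidHom)
        (mapHom f x) :=
  Units.ext rfl

variable [TopologicalSpace R] [IsTopologicalRing R]

/-- **`Sp(J)(R) → GL_{2l}(R)` is continuous** from the matrix topology to Mathlib's units topology (both `x ↦ x` and
`x ↦ x⁻¹ = −J xᵀ J` are continuous matrix-valued maps). [cite: Milne2005ShimuraVarieties, §4 p. 48] -/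
theorem continuous_unitsMap_toUnits :
    Continuous ((Units.map (Matrix.symplecticGroup l R).subtype).comp
      (toUnits (G := Matrix.symplecticGroup l R)).toMonoidHom) := by
  refine Units.continuous_iff.2 ⟨continuous_subtype_val, ?_⟩
  have h : ∀ x : Matrix.symplecticGroup l R,
      (↑((((Units.map (Matrix.symplecticGroup l R).subtype).comp
          (toUnits (G := Matrix.symplecticGroup l R)).toMonoidHom) x)⁻¹) : Matrix (l ⊕ l) (l ⊕ l) R) =
        ((x⁻¹ : Matrix.symplecticGroup l R) : Matrix (l ⊕ l) (l ⊕ l) R) := by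
    intro x
    rw [← map_inv]
    rfl
  exact (continuous_subtype_val.comp Literature.NumberTheory.Automorphic.continuous_symplecticGroup_inv).congr
    fun x => (h x).symm

end Bridge

/-! ### §2. The change of basis `P_δ` over `ℚ` and over `𝔸_{ℚ,f}` -/

section ChangeOfBasis

variable {g : ℕ} (δ : Fin g → ℕ)

/-- **One rational change of basis serves both `ℚ` and `𝔸_{ℚ,f}`**: there is `P_δ ∈ GL_{2g}(ℚ)` with
`Sp(E_δ)(ℚ) = P_δ⁻¹·Sp(J)(ℚ)·P_δ` and `Sp(E_δ)(𝔸_{ℚ,f}) = P_δ⁻¹·Sp(J)(𝔸_{ℚ,f})·P_δ` for its image `P_δ ∈ GL_{2g}(𝔸_{ℚ,f})`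
(★ `SymplecticFormTransport`). [cite: Milne2005ShimuraVarieties, §6 p. 67] -/
theorem exists_rational_changeOfBasis (hδ : ∀ i, 0 < δ i) :
    ∃ PQ : GL (Fin g ⊕ Fin g) ℚ,
      symplecticGroupOfForm (typeFormOver δ ℚ) =
          (symplecticGroupOfForm (Matrix.J (Fin g) ℚ)).map (MulAut.conj PQ⁻¹).toMonoidHom ∧
        symplecticGroupOfForm (typeFormOver δ finAdeleQ) =
          (symplecticGroupOfForm (Matrix.J (Fin g) finAdeleQ)).map
            (MulAut.conj (Matrix.GeneralLinearGroup.map (algebraMap ℚ finAdeleQ) PQ)⁻¹).toMonoidHom := by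
  obtain ⟨uQ, huQ⟩ := exists_units_coe_eq_natCast ℚ δ hδ
  obtain ⟨PQ, hPQ⟩ := exists_generalLinearGroup_coe_eq_fromBlocks ℚ uQ
  refine ⟨PQ, symplecticGroupOfForm_typeFormOver_eq_map_conj ℚ δ uQ huQ PQ hPQ, ?_⟩
  -- the adelic unit family and the image of `PQ`
  let uA : Fin g → finAdeleQˣ := fun i => Units.map (algebraMap ℚ finAdeleQ).toMonoidHom (uQ i)
  have huA : ∀ i, (uA i : finAdeleQ) = δ i := fun i => by
    simp only [uA, Units.coe_map, RingHom.toMonoidHom_eq_coe, MonoidHom.coe_coe, huQ, map_natCast]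
  have hPQ' : (PQ : Matrix (Fin g ⊕ Fin g) (Fin g ⊕ Fin g) ℚ) =
      Matrix.fromBlocks (1 : Matrix (Fin g) (Fin g) ℚ) 0 0 (Matrix.diagonal fun i => (δ i : ℚ)) := by
    rw [hPQ]; simp only [huQ]
  have hP : ((Matrix.GeneralLinearGroup.map (algebraMap ℚ finAdeleQ) PQ : GL (Fin g ⊕ Fin g) finAdeleQ) :
      Matrix (Fin g ⊕ Fin g) (Fin g ⊕ Fin g) finAdeleQ) =
        Matrix.fromBlocks (1 : Matrix (Fin g) (Fin g) finAdeleQ) 0 0 (Matrix.diagonal fun i => (uA i : finAdeleQ)) := by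
    rw [generalLinearGroup_map_coe_eq_fromBlocks (algebraMap ℚ finAdeleQ) δ PQ hPQ']
    simp only [huA]
  exact symplecticGroupOfForm_typeFormOver_eq_map_conj finAdeleQ δ uA huA _ hP

end ChangeOfBasis

/-! ### §3. Common multiplier ⇒ same index -/

namespace SiegelShimuraSet

variable {g : ℕ} (δ : Fin g → ℕ) (K : Subgroup (gspFinAdelic δ))

/-- **Two points of `GSp_δ(𝔸_{ℚ,f})` with a common multiplier lie in the same double coset `GSp_δ(ℚ)·a·K`** for every OPEN
subgroup `K` (`0 < δ_i`): the class `GSp_δ(ℚ) a K = indexOf δ K a` of ★ R60-13 depends on `a` only through `ν(a)` modulo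
`ℚ^× · ν(K)`.  Strong approximation for `Sp_{2g}` ([Milne2005ShimuraVarieties] Thm. 4.16; Lemma 5.12: «the fibres of `ν` are
… trivial since `G'` is simply connected») transported to the type-`δ` form.
[cite: Milne2005ShimuraVarieties, §4 Thm. 4.16 p. 48, Lemma 5.12 p. 57, Thm. 5.17 p. 59] [cite: PlatonovRapinchuk1994, §7.4 Thm. 7.12] -/
theorem doubleCosetMk_eq_of_isMultiplier (hδ : ∀ i, 0 < δ i) (hK : IsOpen (K : Set (gspFinAdelic δ)))
    {a b : gspFinAdelic δ} {ν : finAdeleQˣ}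
    (ha : IsMultiplier (typeFormOver δ finAdeleQ) (a : GL (Fin g ⊕ Fin g) finAdeleQ) ν)
    (hb : IsMultiplier (typeFormOver δ finAdeleQ) (b : GL (Fin g ⊕ Fin g) finAdeleQ) ν) :
    DoubleCoset.mk (gspRationalToFinAdelic δ).range K a = DoubleCoset.mk (gspRationalToFinAdelic δ).range K b := by
  classical
  obtain ⟨PQ, hSpQ, hSpA⟩ := exists_rational_changeOfBasis δ hδ
  -- abbreviations
  set P : GL (Fin g ⊕ Fin g) finAdeleQ := Matrix.GeneralLinearGroup.map (algebraMap ℚ finAdeleQ) PQ with hP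
  set φ : Matrix.symplecticGroup (Fin g) finAdeleQ →* GL (Fin g ⊕ Fin g) finAdeleQ :=
    (Units.map (Matrix.symplecticGroup (Fin g) finAdeleQ).subtype).comp
      (toUnits (G := Matrix.symplecticGroup (Fin g) finAdeleQ)).toMonoidHom with hφ
  set φQ : Matrix.symplecticGroup (Fin g) ℚ →* GL (Fin g ⊕ Fin g) ℚ :=
    (Units.map (Matrix.symplecticGroup (Fin g) ℚ).subtype).comp
      (toUnits (G := Matrix.symplecticGroup (Fin g) ℚ)).toMonoidHom with hφQ
  have hφval : ∀ y : Matrix.symplecticGroup (Fin g) finAdeleQ,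
      ((φ y : GL (Fin g ⊕ Fin g) finAdeleQ) : Matrix (Fin g ⊕ Fin g) (Fin g ⊕ Fin g) finAdeleQ) = y := fun y => rfl
  have hφQval : ∀ y : Matrix.symplecticGroup (Fin g) ℚ,
      ((φQ y : GL (Fin g ⊕ Fin g) ℚ) : Matrix (Fin g ⊕ Fin g) (Fin g ⊕ Fin g) ℚ) = y := fun y => rfl
  -- `s = b a⁻¹ ∈ Sp(E_δ)(𝔸_f)`, and `X = P s P⁻¹ ∈ Sp(J)(𝔸_f)`
  have hs : ((b : GL (Fin g ⊕ Fin g) finAdeleQ) * (a : GL (Fin g ⊕ Fin g) finAdeleQ)⁻¹) ∈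
      symplecticGroupOfForm (typeFormOver δ finAdeleQ) := hb.mul_inv_mem_symplecticGroupOfForm ha
  have hx : ((P * ((b : GL (Fin g ⊕ Fin g) finAdeleQ) * (a : GL (Fin g ⊕ Fin g) finAdeleQ)⁻¹) * P⁻¹ :
      GL (Fin g ⊕ Fin g) finAdeleQ) : Matrix (Fin g ⊕ Fin g) (Fin g ⊕ Fin g) finAdeleQ) ∈
        Matrix.symplecticGroup (Fin g) finAdeleQ := by
    rw [hSpA, mem_map_conj_inv_iff, mem_symplecticGroupOfForm_J_iff] at hs
    exact hs
  set X : Matrix.symplecticGroup (Fin g) finAdeleQ := ⟨_, hx⟩ with hX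
  have hφX : φ X = P * ((b : GL (Fin g ⊕ Fin g) finAdeleQ) * (a : GL (Fin g ⊕ Fin g) finAdeleQ)⁻¹) * P⁻¹ :=
    Units.ext rfl
  -- the open set `V ⊆ GL_{2g}(𝔸_f)` cutting out `K`
  obtain ⟨V, hV, hVK⟩ := isOpen_induced_iff.mp hK
  -- the conjugator `c = P a` and the open subgroup `U = {y ∈ Sp(J)(𝔸_f) | c⁻¹ y c ∈ K}`
  set c : GL (Fin g ⊕ Fin g) finAdeleQ := P * (a : GL (Fin g ⊕ Fin g) finAdeleQ) with hc
  let U : Subgroup (Matrix.symplecticGroup (Fin g) finAdeleQ) :=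
    ((K.map (gspFinAdelic δ).subtype).map (MulAut.conj c).toMonoidHom).comap φ
  have hU_mem : ∀ y, y ∈ U ↔ ∃ k ∈ K, ((k : gspFinAdelic δ) : GL (Fin g ⊕ Fin g) finAdeleQ) = c⁻¹ * φ y * c := by
    intro y
    change φ y ∈ ((K.map (gspFinAdelic δ).subtype).map (MulAut.conj c).toMonoidHom) ↔ _
    rw [Subgroup.mem_map_equiv, MulAut.conj_symm_apply, Subgroup.mem_map]
    rfl
  -- every `c⁻¹ (φ y) c` lies in `GSp_δ(𝔸_f)` automatically
  have hauto : ∀ y : Matrix.symplecticGroup (Fin g) finAdeleQ, c⁻¹ * φ y * c ∈ gspFinAdelic δ := by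
    intro y
    have h1 : P⁻¹ * φ y * P ∈ symplecticGroupOfForm (typeFormOver δ finAdeleQ) := by
      rw [hSpA, mem_map_conj_inv_iff, mem_symplecticGroupOfForm_J_iff]
      have : P * (P⁻¹ * φ y * P) * P⁻¹ = φ y := by group
      rw [this, hφval]
      exact y.2
    have h3 : c⁻¹ * φ y * c =
        (a : GL (Fin g ⊕ Fin g) finAdeleQ)⁻¹ * (P⁻¹ * φ y * P) * (a : GL (Fin g ⊕ Fin g) finAdeleQ) := by
      rw [hc]; group
    rw [h3]
    exact Subgroup.mul_mem _ (Subgroup.mul_mem _ (Subgroup.inv_mem _ a.2)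
      (symplecticGroupOfForm_le_similitudeGroupOfForm _ h1)) a.2
  have hUset : (U : Set (Matrix.symplecticGroup (Fin g) finAdeleQ)) = (fun y => c⁻¹ * φ y * c) ⁻¹' V := by
    ext y
    rw [SetLike.mem_coe, hU_mem, Set.mem_preimage]
    constructor
    · rintro ⟨k, hk, hkc⟩
      have hk' : (k : gspFinAdelic δ) ∈ Subtype.val ⁻¹' V := by rw [hVK]; exact hk
      rwa [Set.mem_preimage, hkc] at hk'
    · intro hy
      refine ⟨⟨c⁻¹ * φ y * c, hauto y⟩, ?_, rfl⟩
      have hy' : (⟨c⁻¹ * φ y * c, hauto y⟩ : gspFinAdelic δ) ∈ Subtype.val ⁻¹' V := hy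
      rwa [hVK] at hy'
  have hUopen : IsOpen (U : Set (Matrix.symplecticGroup (Fin g) finAdeleQ)) := by
    rw [hUset]
    exact hV.preimage ((continuous_const.mul continuous_unitsMap_toUnits).mul continuous_const)
  -- STRONG APPROXIMATION for `Sp_{2g}`: `X = γ u`, `γ` rational, `u ∈ U`
  obtain ⟨γ, u, huU, hγu⟩ :=
    Literature.NumberTheory.Automorphic.exists_symplecticGroup_map_mul_eq_of_isOpen (𝓞 ℚ) ℚ U hUopen X
  obtain ⟨k, hkK, hk⟩ := (hU_mem u).1 huU
  -- the rational element `γ' = PQ⁻¹ γ PQ ∈ Sp(E_δ)(ℚ) ≤ GSp_δ(ℚ)`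
  have hγQ : PQ⁻¹ * φQ γ * PQ ∈ symplecticGroupOfForm (typeFormOver δ ℚ) := by
    rw [hSpQ, mem_map_conj_inv_iff, mem_symplecticGroupOfForm_J_iff]
    have : PQ * (PQ⁻¹ * φQ γ * PQ) * PQ⁻¹ = φQ γ := by group
    rw [this, hφQval]
    exact γ.2
  let γR : gspRational δ := ⟨PQ⁻¹ * φQ γ * PQ, symplecticGroupOfForm_le_similitudeGroupOfForm _ hγQ⟩
  have hγR : ((gspRationalToFinAdelic δ γR : gspFinAdelic δ) : GL (Fin g ⊕ Fin g) finAdeleQ) =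
      P⁻¹ * φ (mapHom (algebraMap ℚ finAdeleQ) γ) * P := by
    rw [coe_gspRationalToFinAdelic]
    change Matrix.GeneralLinearGroup.map (algebraMap ℚ finAdeleQ) (PQ⁻¹ * φQ γ * PQ) = _
    rw [map_mul, map_mul, map_inv, hφQ, generalLinearGroup_map_unitsMap_toUnits]
  -- `φ u = c k c⁻¹`
  have hφu : φ u = c * ((k : gspFinAdelic δ) : GL (Fin g ⊕ Fin g) finAdeleQ) * c⁻¹ := by
    rw [hk]; group
  -- assemble `b = γ' a k` in `GL_{2g}(𝔸_f)`
  have hXeq : P * ((b : GL (Fin g ⊕ Fin g) finAdeleQ) * (a : GL (Fin g ⊕ Fin g) finAdeleQ)⁻¹) * P⁻¹ =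
      φ (mapHom (algebraMap ℚ finAdeleQ) γ) * φ u := by
    rw [← hφX, ← hγu, map_mul]
  have hb_eq : (b : GL (Fin g ⊕ Fin g) finAdeleQ) =
      ((gspRationalToFinAdelic δ γR : gspFinAdelic δ) : GL (Fin g ⊕ Fin g) finAdeleQ) *
        (a : GL (Fin g ⊕ Fin g) finAdeleQ) * ((k : gspFinAdelic δ) : GL (Fin g ⊕ Fin g) finAdeleQ) := by
    rw [hγR]
    rw [hφu, hc] at hXeq
    calc (b : GL (Fin g ⊕ Fin g) finAdeleQ)
        = P⁻¹ * (P * ((b : GL (Fin g ⊕ Fin g) finAdeleQ) * (a : GL (Fin g ⊕ Fin g) finAdeleQ)⁻¹) * P⁻¹) * P *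
            (a : GL (Fin g ⊕ Fin g) finAdeleQ) := by group
      _ = P⁻¹ * (φ (mapHom (algebraMap ℚ finAdeleQ) γ) *
            (P * (a : GL (Fin g ⊕ Fin g) finAdeleQ) * ((k : gspFinAdelic δ) : GL (Fin g ⊕ Fin g) finAdeleQ) *
              (P * (a : GL (Fin g ⊕ Fin g) finAdeleQ))⁻¹)) * P * (a : GL (Fin g ⊕ Fin g) finAdeleQ) := by rw [hXeq]
      _ = P⁻¹ * φ (mapHom (algebraMap ℚ finAdeleQ) γ) * P * (a : GL (Fin g ⊕ Fin g) finAdeleQ) *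
            ((k : gspFinAdelic δ) : GL (Fin g ⊕ Fin g) finAdeleQ) := by group
  -- conclude in the double coset space
  rw [DoubleCoset.eq]
  refine ⟨gspRationalToFinAdelic δ γR, ⟨γR, rfl⟩, k, hkK, ?_⟩
  apply Subtype.ext
  simp only [Subgroup.coe_mul]
  exact hb_eq

/-- The same, read on ★ R60-13's `indexOf`: **`indexOf δ K a = indexOf δ K b` for `a, b` with a common multiplier**
(`K` open, `0 < δ_i`). [cite: Milne2005ShimuraVarieties, Lemma 5.12 p. 57, Thm. 5.17 p. 59] -/
theorem doubleCosetMk_eq_of_isMultiplier' (hδ : ∀ i, 0 < δ i) (hK : IsOpen (K : Set (gspFinAdelic δ)))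
    {a b : gspFinAdelic δ} {ν μ : finAdeleQˣ}
    (ha : IsMultiplier (typeFormOver δ finAdeleQ) (a : GL (Fin g ⊕ Fin g) finAdeleQ) ν)
    (hb : IsMultiplier (typeFormOver δ finAdeleQ) (b : GL (Fin g ⊕ Fin g) finAdeleQ) μ) (hνμ : ν = μ) :
    DoubleCoset.mk (gspRationalToFinAdelic δ).range K a = DoubleCoset.mk (gspRationalToFinAdelic δ).range K b := by
  subst hνμ
  exact doubleCosetMk_eq_of_isMultiplier δ K hδ hK ha hb

/-- **Moving inside a double coset changes the multiplier by `ℚ^× · ν(K)`**: for `γ ∈ GSp_δ(ℚ)` with multiplier `q`, `k ∈ K`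
with multiplier `t` and `a` with multiplier `ν`, the point `γ a k` has multiplier `q ν t` (as finite idèles) — the easy
direction of [Milne2005ShimuraVarieties] Lemma 5.12. [cite: Milne2005ShimuraVarieties, Lemma 5.12 p. 57] -/
theorem isMultiplier_rational_mul_mul {a k : gspFinAdelic δ} {γ : gspRational δ} {ν t : finAdeleQˣ} {q : ℚˣ}
    (hγ : IsMultiplier (typeFormOver δ ℚ) (γ : GL (Fin g ⊕ Fin g) ℚ) q)
    (ha : IsMultiplier (typeFormOver δ finAdeleQ) (a : GL (Fin g ⊕ Fin g) finAdeleQ) ν)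
    (hk : IsMultiplier (typeFormOver δ finAdeleQ) (k : GL (Fin g ⊕ Fin g) finAdeleQ) t) :
    IsMultiplier (typeFormOver δ finAdeleQ)
      ((gspRationalToFinAdelic δ γ * a * k : gspFinAdelic δ) : GL (Fin g ⊕ Fin g) finAdeleQ)
      (Units.map (algebraMap ℚ finAdeleQ).toMonoidHom q * ν * t) := by
  have hγA : IsMultiplier (typeFormOver δ finAdeleQ)
      ((gspRationalToFinAdelic δ γ : gspFinAdelic δ) : GL (Fin g ⊕ Fin g) finAdeleQ)
      (Units.map (algebraMap ℚ finAdeleQ).toMonoidHom q) := by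
    have h := hγ.map (algebraMap ℚ finAdeleQ)
    rwa [typeFormOver_map] at h
  simpa only [Subgroup.coe_mul] using (hγA.mul ha).mul hk

/-- **★ R60-13 spelling: `indexOf δ K a = indexOf δ K b` for `a, b ∈ GSp_δ(𝔸_{ℚ,f})` with a common multiplier** (`K` open,
`0 < δ_i`) — the piece index `Ξ_K` is read through `ν`. [cite: Milne2005ShimuraVarieties, Lemma 5.12 p. 57, Thm. 5.17 p. 59] -/
theorem indexOf_eq_indexOf_of_isMultiplier (hδ : ∀ i, 0 < δ i) (hK : IsOpen (K : Set (gspFinAdelic δ)))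
    {a b : gspFinAdelic δ} {ν : finAdeleQˣ}
    (ha : IsMultiplier (typeFormOver δ finAdeleQ) (a : GL (Fin g ⊕ Fin g) finAdeleQ) ν)
    (hb : IsMultiplier (typeFormOver δ finAdeleQ) (b : GL (Fin g ⊕ Fin g) finAdeleQ) ν) :
    indexOf δ K a = indexOf δ K b :=
  doubleCosetMk_eq_of_isMultiplier δ K hδ hK ha hb

/-- **The class `[J, aK] ∈ Sh_K(GSp_δ, S^±)(ℂ)` has piece index determined by `ν(a)`**: two classes whose adelic parts have a
common multiplier lie over the same index (★ R60-13 `index`). [cite: Milne2005ShimuraVarieties, Lemma 5.13 p. 57] -/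
theorem index_mk_eq_index_mk_of_isMultiplier (hδ : ∀ i, 0 < δ i) (hK : IsOpen (K : Set (gspFinAdelic δ)))
    (J J' : C0pm δ) {a b : gspFinAdelic δ} {ν : finAdeleQˣ}
    (ha : IsMultiplier (typeFormOver δ finAdeleQ) (a : GL (Fin g ⊕ Fin g) finAdeleQ) ν)
    (hb : IsMultiplier (typeFormOver δ finAdeleQ) (b : GL (Fin g ⊕ Fin g) finAdeleQ) ν) :
    index δ K (SiegelShimuraSet.mk δ K J a) = index δ K (SiegelShimuraSet.mk δ K J' b) := by
  rw [index_mk, index_mk]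
  exact indexOf_eq_indexOf_of_isMultiplier δ K hδ hK ha hb

end SiegelShimuraSet

end Literature.AlgebraicGeometry.ModuliOfAbelianVarieties

end
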